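import Literature.Algebra.EuclideanLattices.IntegerMatrixInverseGS
import Literature.Computability.QuantumComplexity.GramSchmidtTableMachine
import HarnessLib

/-!
# The exact inverse of a nonsingular integer matrix is typed polynomial time

Topic `Algebra/EuclideanLattices`, machine side of `IntegerMatrixInverseGS.lean` (for square integer
`rows` with independent rows, the integer columns `gₖ = invCol rows k` and the denominator
`dₙ = invDen rows` satisfy `T [g₀|⋯|g_{n-1}] = dₙ I`, `dₙ = det(T)²`, everything read off Cohen's
integral Gram–Schmidt table of the reordered rows followed by the unit vectors). Here that list
program is proved polynomial-time computable in the typed sense of `CodeFP.lean`, from the typed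
Gram–Schmidt table `Literature.Computability.QuantumComplexity.levelsOf_codeFP`
(`GramSchmidtTableMachine.lean`) and the list combinators of `CodeFP.lean` / `CodeFPArith.lean`:

* `unitRows_codeFP` (`1ⁿ ↦` the rows of `Iₙ`), `moveLast_codeFP`, `invFamily_codeFP`;
* `lastTable_codeFP` — `fam ↦ tableRec fam n (n-1)` for `n = |rows|` (entry `n - 1` of `levelsOf`);
* **`invCol_codeFP`**, **`invCols_codeFP`**, **`invDen_codeFP`**, and the pair
  **`invData_codeFP : rows ↦ (invDen rows, invCols rows)`** — the exact rational inverse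
  `T⁻¹ = [g₀|⋯|g_{n-1}]/dₙ` of a nonsingular integer matrix, with integers only, in polynomial time.

No machine, transducer or size estimate is written: the one size estimate of the whole computation is
inside `levelsOf_codeFP` (Cohen's universal entry bound), and `CodeFP.map` discharges the rest.

## References

* H. Cohen, *A Course in Computational Algebraic Number Theory*, GTM 138, Springer 1993, §2.6.3 and
  Algorithm 2.6.7 (integral Gram–Schmidt; all quantities are integers of polynomial size).
* S. Arora, B. Barak, *Computational Complexity: A Modern Approach*, CUP 2009, §1.3 (closure of
  polynomial time under composition and polynomially bounded loops).
-/

noncomputable section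

namespace Literature.Algebra.EuclideanLattices

namespace GSInverse

open Literature.Computability.Complexity Literature.Computability.Complexity.CodeFP
  Literature.Computability.QuantumComplexity

/-- The code of a matrix of integers: raw list of raw lists of difference pairs. [folklore] -/
abbrev rowsE : List (List ℤ) → List Bool := rawE (rawE intE)

/-! ### The families -/

/-- **`1ⁿ ↦ unitRows n`** is typed polynomial time. [cite: AroraBarak2009, §1.3] -/
theorem unitRows_codeFP : CodeFP unE rowsE unitRows := by
  -- the entry `(t, s) ↦ [s = t]`
  have hent : CodeFP (pairE natE natE) intE (fun p => if p.2 = p.1 then (1 : ℤ) else 0) := by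
    have hp : CodeFP (pairE natE natE) bitE (fun p => decide (p.2 = p.1)) :=
      natEq.comp ((snd _ _).pair (fst _ _))
    refine (ite hp (const _ (1 : ℤ)) (const _ (0 : ℤ))).congr fun p => ?_
    simp
  -- the row `(t, range) ↦ range.map (s ↦ [s = t])`
  have hrow : CodeFP (pairE natE (rawE natE)) (rawE intE)
      (fun p => p.2.map fun s => if s = p.1 then (1 : ℤ) else 0) := by
    exact (map (σ := ℕ) (g := fun q : ℕ × ℕ => if q.2 = q.1 then (1 : ℤ) else 0) hent :)
  -- all rows `(range, range) ↦ …`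
  have hall : CodeFP (pairE (rawE natE) (rawE natE)) rowsE
      (fun p => p.2.map fun t => p.1.map fun s => if s = t then (1 : ℤ) else 0) := by
    exact (map (σ := List ℕ) (g := fun q : List ℕ × ℕ => q.1.map fun s => if s = q.2 then (1 : ℤ) else 0)
      (hrow.comp ((snd _ _).pair (fst _ _))) :)
  exact (hall.comp (urange.pair urange)).congr fun n => rfl

/-- `take` by a binary count capped at the length is `take`. [folklore] -/
theorem take_min_length {α : Type} (l : List α) (k : ℕ) : l.take (min k l.length) = l.take k := by
  rcases le_total k l.length with h | h
  · rw [min_eq_left h]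
  · rw [min_eq_right h, List.take_length, List.take_of_length_le h]

/-- `drop` by a binary count capped at the length is `drop`. [folklore] -/
theorem drop_min_length {α : Type} (l : List α) (k : ℕ) : l.drop (min k l.length) = l.drop k := by
  rcases le_total k l.length with h | h
  · rw [min_eq_left h]
  · rw [min_eq_right h, List.drop_length, List.drop_of_length_le h]

/-- **`(rows, k) ↦ moveLast rows k`** is typed polynomial time. [cite: AroraBarak2009, §1.3] -/
theorem moveLast_codeFP : CodeFP (pairE rowsE natE) rowsE (fun p => moveLast p.1 p.2) := by
  -- unary counts `min k |rows|`, `min (k+1) |rows|`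
  have hlen : CodeFP (pairE rowsE natE) unE (fun p => p.1.length) := (ulength _).comp (fst _ _)
  have hk : CodeFP (pairE rowsE natE) unE (fun p => min p.2 p.1.length) :=
    unOfNatMin.comp (hlen.pair (snd _ _))
  have hk1 : CodeFP (pairE rowsE natE) unE (fun p => min (p.2 + 1) p.1.length) :=
    unOfNatMin.comp (hlen.pair (natAdd.comp ((snd _ _).pair (const _ (1 : ℕ)))))
  have htake : CodeFP (pairE rowsE natE) rowsE (fun p => p.1.take (min p.2 p.1.length)) :=
    (rawTakeUn _).comp (hk.pair (fst _ _))
  have hdrop : CodeFP (pairE rowsE natE) rowsE (fun p => p.1.drop (min (p.2 + 1) p.1.length)) :=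
    (rawDropUn _).comp (hk1.pair (fst _ _))
  have hlast : CodeFP (pairE rowsE natE) rowsE (fun p => [p.1.getD p.2 []]) :=
    (rawSingleton _).comp (rawGetD (rawE intE) (d := ([] : List ℤ)) rfl)
  have h := (rawAppend (rawE intE)).comp (htake.pair ((rawAppend (rawE intE)).comp (hdrop.pair hlast)))
  refine h.congr fun p => ?_
  simp only [moveLast, take_min_length, drop_min_length]

/-- **`(rows, k) ↦ invFamily rows k`** is typed polynomial time. [cite: AroraBarak2009, §1.3] -/
theorem invFamily_codeFP : CodeFP (pairE rowsE natE) rowsE (fun p => invFamily p.1 p.2) := by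
  have hunit : CodeFP (pairE rowsE natE) rowsE (fun p => unitRows p.1.length) :=
    unitRows_codeFP.comp ((ulength _).comp (fst _ _))
  exact ((rawAppend (rawE intE)).comp (moveLast_codeFP.pair hunit)).congr fun p => rfl

/-! ### Reading Cohen's table -/

/-- The code of one level of Cohen's table with its `d`. [folklore] -/
abbrev levelE : ℤ × List (List ℤ) → List Bool := pairE intE rowsE

/-- **`(fam, n) ↦ (levelsOf fam n n)[n-1]`** (default `(0, [])`): the level `n - 1` of Cohen's table of
`fam` on `n` columns, with `d_{n-1}`. [cite: Cohen1993, Algorithm 2.6.7] -/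
theorem levelAt_codeFP : CodeFP (pairE rowsE unE) levelE
    (fun p => (levelsOf p.1 p.2 p.2).getD (p.2 - 1) ((0 : ℤ), ([] : List (List ℤ)))) := by
  have hlev : CodeFP (pairE rowsE unE) (rawE levelE) (fun p => levelsOf p.1 p.2 p.2) :=
    levelsOf_codeFP.comp ((snd _ _).pair ((snd _ _).pair (fst _ _)))
  have hidx : CodeFP (pairE rowsE unE) natE (fun p => p.2 - 1) :=
    natSub.comp ((natOfUn.comp (snd _ _)).pair (const _ (1 : ℕ)))
  exact ((rawGetOr levelE).comp (hlev.pair (hidx.pair (const _ ((0 : ℤ), ([] : List (List ℤ))))))).congr fun p => rfl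

/-- The level read off is `(d_{n-1}, tableRec fam n (n-1))` as soon as `n ≥ 1`. [folklore] -/
theorem levelsOf_getD_pred (fam : List (List ℤ)) {n : ℕ} (hn : 0 < n) :
    (levelsOf fam n n).getD (n - 1) ((0 : ℤ), ([] : List (List ℤ))) = (dList fam n (n - 1), tableRec fam n (n - 1)) := by
  rw [levelsOf_eq, List.getD_eq_getElem _ _ (by simp; omega)]
  simp

/-- The level `n` of `levelsOf rows n (n+1)` is `(dₙ, tableRec rows n n)`. [folklore] -/
theorem levelsOf_getD_self (rows : List (List ℤ)) (n : ℕ) :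
    (levelsOf rows n (n + 1)).getD n ((0 : ℤ), ([] : List (List ℤ))) = (dList rows n n, tableRec rows n n) := by
  rw [levelsOf_eq, List.getD_eq_getElem _ _ (by simp)]
  simp

/-! ### The columns and the denominator -/

/-- **`(rows, k) ↦ invCol rows k`** is typed polynomial time. [cite: Cohen1993, §2.6.3; AroraBarak2009 §1.3] -/
theorem invCol_codeFP : CodeFP (pairE rowsE natE) (rawE intE) (fun p => invCol p.1 p.2) := by
  -- the table at level `n - 1` of `invFamily rows k`, with `n = |rows|`
  have htab : CodeFP (pairE rowsE natE) rowsE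
      (fun p => ((levelsOf (invFamily p.1 p.2) p.1.length p.1.length).getD (p.1.length - 1)
        ((0 : ℤ), ([] : List (List ℤ)))).2) :=
    (levelAt_codeFP.comp (invFamily_codeFP.pair ((ulength _).comp (fst _ _)))).snd'
  have hn : CodeFP (pairE rowsE natE) natE (fun p => p.1.length) := (natLength _).comp (fst _ _)
  -- the entry `((TAB, n), t) ↦ tabEntry TAB (n + t) (n - 1)`
  have hent : CodeFP (pairE (pairE rowsE natE) natE) intE
      (fun q => tabEntry q.1.1 (q.1.2 + q.2) (q.1.2 - 1)) := by
    exact (tabEntry_codeFP.comp ((fst _ _).fst'.pair ((natAdd.comp ((fst _ _).snd'.pair (snd _ _))).pair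
      (natSub.comp ((fst _ _).snd'.pair (const _ (1 : ℕ)))))) :)
  have hmap : CodeFP (pairE (pairE rowsE natE) (rawE natE)) (rawE intE)
      (fun q => q.2.map fun t => tabEntry q.1.1 (q.1.2 + t) (q.1.2 - 1)) := by
    exact (map (σ := List (List ℤ) × ℕ) (g := fun q => tabEntry q.1.1 (q.1.2 + q.2) (q.1.2 - 1)) hent :)
  have hrange : CodeFP (pairE rowsE natE) (rawE natE) (fun p => List.range p.1.length) :=
    urange.comp ((ulength _).comp (fst _ _))
  have h := hmap.comp ((htab.pair hn).pair hrange)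
  refine h.congr fun p => ?_
  rcases Nat.eq_zero_or_pos p.1.length with h0 | hpos
  · simp [invCol, h0]
  · simp only [invCol, levelsOf_getD_pred _ hpos]

/-- **`rows ↦ invCols rows`** is typed polynomial time. [cite: Cohen1993, §2.6.3; AroraBarak2009 §1.3] -/
theorem invCols_codeFP : CodeFP rowsE rowsE invCols := by
  have hmap : CodeFP (pairE rowsE (rawE natE)) rowsE (fun p => p.2.map fun k => invCol p.1 k) := by
    exact (map (σ := List (List ℤ)) (g := fun q : List (List ℤ) × ℕ => invCol q.1 q.2) invCol_codeFP :)
  refine (hmap.comp ((CodeFP.id _).pair (urange.comp (ulength _)))).congr fun rows => ?_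
  simp only [invCols, id]

/-- **`rows ↦ invDen rows = dₙ`** is typed polynomial time. [cite: Cohen1993, §2.6.3; AroraBarak2009 §1.3] -/
theorem invDen_codeFP : CodeFP rowsE intE invDen := by
  have hK : CodeFP rowsE unE (fun rows => rows.length + 1) := unSucc.comp (ulength (rawE intE))
  have hC : CodeFP rowsE unE (fun rows => rows.length) := ulength (rawE intE)
  have harg : CodeFP rowsE (pairE unE (pairE unE rowsE)) (fun rows => (rows.length + 1, (rows.length, rows))) :=
    hK.pair (hC.pair (CodeFP.id rowsE))
  have hlev : CodeFP rowsE (rawE levelE) (fun rows => levelsOf rows rows.length (rows.length + 1)) :=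
    levelsOf_codeFP.comp harg
  have hn : CodeFP rowsE natE (fun rows => rows.length) := natLength (rawE intE)
  have hget := ((rawGetOr levelE).comp (hlev.pair (hn.pair (const rowsE ((0 : ℤ), ([] : List (List ℤ))))))).fst'
  refine hget.congr fun rows => ?_
  simp only [levelsOf_getD_self, invDen]

/-- **The exact inverse of an integer matrix in typed polynomial time**: `rows ↦ (invDen rows, invCols rows)`
— for square `rows` with independent rows (a nonsingular `T`), `T · [g₀|⋯|g_{n-1}] = dₙ · I` with
`dₙ = det(T)²` (`GSInverse.dotZ_invCol`, `GSInverse.mul_invMatrix`), so `T⁻¹ = [g₀|⋯|g_{n-1}]/dₙ`.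
[cite: Cohen1993, §2.6.3; AroraBarak2009 §1.3] -/
theorem invData_codeFP : CodeFP rowsE (pairE intE rowsE) (fun rows => (invDen rows, invCols rows)) :=
  invDen_codeFP.pair invCols_codeFP

end GSInverse

end Literature.Algebra.EuclideanLattices

end
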